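import Summits.BirchSwinnertonDyer.BirchSwinnertonDyer.Theorems.PrintCf2SplitBadTwoRestrictedSurjOfConjFiniteness
import Summits.BirchSwinnertonDyer.BirchSwinnertonDyer.Theorems.PrintCf2SplitBadTwoRestrictedSelmerRelaxedConjFiniteness
import Summits.BirchSwinnertonDyer.BirchSwinnertonDyer.Theorems.PrintCf2SplitBadTwoLocalTorsionBoundAtTwo
import HarnessLib

/-!
# Crux `PrintCf2.SplitBadTwoRankOneOfFacts` (stmt-BirchSwinnertonDyer-20368), road α v10.3 — the displayed `hLSfin` of the LEAD's
# cuts 11/12 («(LS) under bottom finiteness»), FROM THE NAMED FACT `poitouTate_selmerStructure_duality` ONLY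

Cell `bsd-print-cf2`, width seat `bsd-line-cf2-p1-w2` g10 (prover-bsd-line-cf2-p1-w2-g10-0); `--supports
stmt-BirchSwinnertonDyer-20368` (helper, Theses-free). HONEST FRAMING: nothing here closes a crux or a stub; every statement below is
CONDITIONAL on the Literature named facts it displays (`poitouTate_selmerStructure_duality`, `poitouTate_sha_tateDual`,
`fieldCdLE_two_of_numberField` — Poitou–Tate duality and `cd₂ ≤ 2`, printed theorems, unproved in the tree); BSD is not proved by any
of this; no summit statement is proved by this seat. THEOREMS ONLY (no definition, no new named fact, no `sorry`).

WHAT. The LEAD's cut 11 `RestrictedSelmerPair.restrictedControl_two_of_locSurj_bv'` (p673411) derives S3c `stub_restrictedControl_two`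
VERBATIM from `hPT`, `hcd`, **`hLSfin`** («(LS) under bottom finiteness» on every frame) and `hBV`. The (LS)/(R-TOP) lane (-w4 g9
p673077, -w5 g3 p673366 `locSurj_of_frame_of_conjFiniteness` / `rSurj''_of_conjFiniteness`) reduced `hLSfin` to `hPTs` plus three
per-frame inputs, ALL NOW THEOREMS of this seat's files: hfinB′ (`ConjTransport.conjTransport_holds`, p672976), hfix
(`CMPrimes.exists_two_pow_nsmul_eq_zero_of_fixed_of_frame`, p673410) and hfinR′ ⟸ hfinB (`ConjTransport.hfinR'_of_frame`). Hence:
* **`locSurjFin_of_poitouTate (hPTs) : <hLSfin of cut 11 / cut 12 VERBATIM>`** — pass it BY NAME for `hLSfin`.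
(The (R-TOP′)/(R-SURJ″) forms `rTop'_of_poitouTate` / `rSurj''_of_poitouTate` landed in -w5 g3's `…RestrictedConjInputsOfFrame` two seconds
before this file's first submission and are NOT restated here.) So S3c ⟸ `hPT ∧ hPTs ∧ hcd ∧ hBV` by cut 11 (resp. `∧ hF1 ∧ hF3 ∧ hH2 ∧ hSel` by
cut 12), and the (R-TOP)/(R-SURJ)/(LS) part of the residual census carries NO per-frame input any more.

References: A. Agboola, Compositio 143 (2007) §3 Prop. 3.2, §5 Prop. 5.1, §6 [Agboola2007]; D. Jetchev, C. Skinner, X. Wan (2017)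
Lemma 3.3.3, Prop. 3.3.2 [JetchevSkinnerWan2017]; R. Greenberg, LNM 1716 (1999) §3–4 [GreenbergLNM1716].
-/

noncomputable section

open scoped Classical ContRepresentation

set_option linter.dupNamespace false
set_option autoImplicit false

namespace Summit.BirchSwinnertonDyer.BirchSwinnertonDyer.Theorems.PrintCf2.ConjTransport

open CategoryTheory NumberField IsDedekindDomain Field WeierstrassCurve
open Literature.NumberTheory.EllipticCurves Literature.NumberTheory.EllipticCurves.GreenbergSelmer
open Literature.NumberTheory.EllipticCurves.Agboola2007
open Literature.NumberTheory.EllipticCurves.IwasawaAlgebra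
open Literature.NumberTheory.EllipticCurves.IwasawaDual
open Literature.NumberTheory.EllipticCurves.ResKernel
open Literature.NumberTheory.GaloisRepresentations
open Literature.NumberTheory.GaloisCohomology
open Summit.BirchSwinnertonDyer.Rank1Residual.X11b
open Summit.BirchSwinnertonDyer.Rank1Residual.X11b.LocBridge
open Summit.BirchSwinnertonDyer.Rank1Residual.X11b.AcSelmer
open Summit.BirchSwinnertonDyer.BirchSwinnertonDyer.Theorems.PrintCf2.RestrictedSelmerPair
open Summit.BirchSwinnertonDyer.BirchSwinnertonDyer.Theorems.GoldfeldGoodTwists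

/-- **`hLSfin` OF CUT 11 (`restrictedControl_two_of_locSurj_bv'`) FROM `poitouTate_selmerStructure_duality` ALONE.** On every frame with
`𝔖_{v̄}(K, W*)` finite, the level-`K` Poitou–Tate surjectivity (LS) for `W* = E[𝔮_r^∞]` away from `v`: -w5 g3's
`locSurj_of_frame_of_conjFiniteness` fed with `hfinR′ := hfinR'_of_frame … hfinB` (conjugation transport) and
`hfix := CMPrimes.exists_two_pow_nsmul_eq_zero_of_fixed_of_frame`. CONDITIONAL on the named fact `hPTs`.
[cite: JetchevSkinnerWan2017, Lemma 3.3.3 and Prop. 3.3.2] [cite: GreenbergLNM1716, §3 Lemma 3.3] -/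
theorem locSurjFin_of_poitouTate
    (hPTs : ∀ (K : Type) [Field K] [NumberField K], poitouTate_selmerStructure_duality K) :
    ∀ (d : ℤ), d ≠ 0 → Squarefree d → d % 4 ≠ 1 →
      ∀ (W : WeierstrassCurve ℚ) [W.IsElliptic] (C : VariableChange ℚ), C • W = cm7.quadraticTwist (d : ℚ) →
      ∀ (K : Type) [Field K] [NumberField K], IsImaginaryQuadratic K →
      ∀ (v vbar : HeightOneSpectrum (𝓞 K)),
        ((2 : ℕ) : 𝓞 K) ∈ v.asIdeal → ((2 : ℕ) : 𝓞 K) ∈ vbar.asIdeal → vbar ≠ v →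
      ∀ (π : (W.baseChange K).endRing), (π : AddMonoid.End (W.baseChange K).geomPoints) * π = π - 2 →
      ∀ (r : ℤ_[2]), r * r = r - 2 →
      Finite (restrictedSelmerBase ↥((W.baseChange K).endEigenPrimaryTorsion 2 π r) 2 vbar) →
      ∀ (S : Finset (HeightOneSpectrum (𝓞 K))), (∀ w ∈ S, ((2 : ℕ) : 𝓞 K) ∉ w.asIdeal ∨ w = vbar) →
      ∀ τ : (w : HeightOneSpectrum (𝓞 K)) → subgroupH1 (decomp (K := K) w) ↥((W.baseChange K).endEigenPrimaryTorsion 2 π r),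
      ∃ g : discreteH1 (absoluteGaloisGroup K) ↥((W.baseChange K).endEigenPrimaryTorsion 2 π r),
        (∀ w ∈ S, ResKernel.resSubgroup (decomp (K := K) w) ↥((W.baseChange K).endEigenPrimaryTorsion 2 π r) g = τ w) ∧
        (∀ w : HeightOneSpectrum (𝓞 K), w ∉ S → ((2 : ℕ) : 𝓞 K) ∉ w.asIdeal →
          ResKernel.resSubgroup (decomp (K := K) w) ↥((W.baseChange K).endEigenPrimaryTorsion 2 π r) g = 0) :=
  fun _ hd0 _ _ W _ C hC K _ _ hK v vbar hv hvbar hne π hrel _ hr hfinB ↦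
    locSurj_of_frame_of_conjFiniteness hd0 W C hC hK hv hvbar hne π hrel hr (hPTs K)
      (hfinR'_of_frame W K hd0 C hC hK v vbar hv hvbar hne π hrel hr hfinB)
      (CMPrimes.exists_two_pow_nsmul_eq_zero_of_fixed_of_frame W K hd0 C hC hK v vbar hv hvbar hne π hrel hr)

end Summit.BirchSwinnertonDyer.BirchSwinnertonDyer.Theorems.PrintCf2.ConjTransport

end
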